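import Summits.Ventures.HodgeRepro2.T5RecordSatakeInertToy
import Summits.Ventures.HodgeRepro2.T5RecordSatakeDegreeIntrinsic
import Summits.Ventures.HodgeRepro2.T5RecordSatakeRecurrenceIntrinsic

/-!
# The degree and the tree recursion at the inert place `(3)` of `ℚ(i)`, as numerals

Tier-5 support N3 / §G-N4.2 (seat p3, gen 78). Files 245 / 248 give, at every place `v` of `K⁺` that stays prime in
the CM field `K` and is good for the Gram matrix `H`, a generator `T₁ = 1_{K_v g₁ K_v}` of the record's spherical
Hecke algebra with `deg T₁ = #(K_v g₁ K_v / K_v) = (N(v)³ + 1) · N(v)` and the tree recursion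
`T₁ T_{n+2} = T_{n+3} + (N(v) − 1) T_{n+2} + N(v)⁴ T_{n+1}`, `T₁² = T₂ + (N(v) − 1) T₁ + (N(v)⁴ + N(v)) T₀`. This
file reads both at the concrete inert place `(3)` of `ℚ(i)` (file 238's `vThreePlus`), where `N(v) = 3`
(`[ℚ(i)⁺ : ℚ] = 1`, so the absolute norm of the prime `(3)` of `𝓞_{ℚ(i)⁺}` is `3`), with `H₀ = diag(1, 1, −1)`:

* `finrank_rat` (`[ℚ(i) : ℚ] = 2`), `finrank_rat_maximalRealSubfield` (`[ℚ(i)⁺ : ℚ] = 1`), `absNorm_span_three`,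
  **`absNorm_vThreePlus`** — `N(vThreePlus) = 3`;
* **`exists_doubleCosetOp_aeval_bijective_and_ncard_record_three`** — some `g₀ ∈ U(1 ⊗ H₀)` has a double coset
  `K_v g₀ K_v` of exactly `84 = 3⁴ + 3` left cosets whose characteristic function generates `H(U(1 ⊗ H₀), K_{(3)})`;
* **`exists_cells_three_term_record_three`** — cells `gₙ` with `T₁ T_{n+2} = T_{n+3} + 2 T_{n+2} + 81 T_{n+1}` and
  `T₁² = T₂ + 2 T₁ + 84 T₀` (`k` of characteristic `0`);
* `exists_generators_and_…` — the same with the generators `l` of `𝓞_{ℚ(i)}` over `𝓞_{ℚ(i)⁺}` supplied by file 235;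
* `three_term_congr` — the generic scalar congruence through which the numerals enter (a `rw` on the scalars inside
  the Hecke terms exceeds the heartbeat budget; the instance arguments of files 245 / 248 are passed explicitly).

§8(d): uses an L-value-free non-vanishing device: NO.
-/

open Matrix NumberField NumberField.IsCMField IsDedekindDomain IsDedekindDomain.HeightOneSpectrum Module Polynomial
  MulAction
open scoped TensorProduct Pointwise
open Summit.Ventures.HodgeRepro2.T5UnitaryGroupForm Summit.Ventures.HodgeRepro2.T5UnitaryHeckeAdjoint
  Summit.Ventures.HodgeRepro2.T5HeckePermutationModule Summit.Ventures.HodgeRepro2.T5HeckeDoubleCoset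
  Summit.Ventures.HodgeRepro2.T5RecordHyperspecial Summit.Ventures.HodgeRepro2.T5GlobalLatticeAlmostAll
  Summit.Ventures.HodgeRepro2.T5FinitePlaceSplitClassification Summit.Ventures.HodgeRepro2.T5RecordSatakeIntrinsic
  Summit.Ventures.HodgeRepro2.T5CMFieldSquareDatum Summit.Ventures.HodgeRepro2.T5RecordSatakeToy
  Summit.Ventures.HodgeRepro2.T5InertPrimeToy Summit.Ventures.HodgeRepro2.T5CMCensusToy
  Summit.Ventures.HodgeRepro2.T5RecordSatakeInertToy Summit.Ventures.HodgeRepro2.T5RecordSatakeDegreeIntrinsic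
  Summit.Ventures.HodgeRepro2.T5RecordSatakeRecurrenceIntrinsic Summit.Ventures.HodgeRepro2.T5SplitPlaceUnitaryGroup
  Summit.Ventures.HodgeRepro2.T5NonSplitPlaceUnitaryGroup Summit.Ventures.HodgeRepro2.T5FinitePlaceCM
  Summit.Ventures.HodgeRepro2.T5StarOfInvolution Summit.Ventures.HodgeRepro2.T5RecordSatake
  Summit.Ventures.HodgeRepro2.T5RecordSatakeInert Summit.Ventures.HodgeRepro2.T5RecordSatakeCell
  Summit.Ventures.HodgeRepro2.T5RecordSatakeDegree Summit.Ventures.HodgeRepro2.T5RecordSatakeRecurrence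

namespace Summit.Ventures.HodgeRepro2.T5RecordSatakeInertToyDegree

section Norm

variable (L : Type*) [Field L] [CharZero L] [IsCyclotomicExtension {2 ^ 2} ℚ L]

/-- `[ℚ(i) : ℚ] = φ(4) = 2` (Mathlib's `IsCyclotomicExtension.finrank` with `Φ₄` irreducible over `ℚ`). -/
theorem finrank_rat : Module.finrank ℚ L = 2 := by
  have hirr : Irreducible (cyclotomic (2 ^ 2) ℚ) := cyclotomic.irreducible_rat (by norm_num)
  rw [IsCyclotomicExtension.finrank L hirr, Nat.totient_prime_pow Nat.prime_two (by norm_num : 0 < 2)]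
  norm_num

/-- `[ℚ(i)⁺ : ℚ] = 1`: the tower law `[ℚ(i)⁺ : ℚ] · [ℚ(i) : ℚ(i)⁺] = [ℚ(i) : ℚ]` with `[ℚ(i) : ℚ(i)⁺] = 2`
(`IsCMField`) and `[ℚ(i) : ℚ] = 2`. -/
theorem finrank_rat_maximalRealSubfield :
    haveI := numberField L; haveI := isCMField_four L
    Module.finrank ℚ (maximalRealSubfield L) = 1 := by
  haveI := numberField L
  haveI := isCMField_four L
  have h := Module.finrank_mul_finrank ℚ (maximalRealSubfield L) L
  rw [Algebra.IsQuadraticExtension.finrank_eq_two (maximalRealSubfield L) L, finrank_rat L] at h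
  omega

/-- The absolute norm of the ideal `(3)` of `𝓞_{ℚ(i)⁺}` is `3^{[ℚ(i)⁺ : ℚ]} = 3`. -/
theorem absNorm_span_three :
    haveI := numberField L; haveI := isCMField_four L
    Ideal.absNorm (Ideal.span {(3 : 𝓞 (maximalRealSubfield L))}) = 3 := by
  haveI := numberField L
  haveI := isCMField_four L
  have h := Ideal.absNorm_span_natCast (S := 𝓞 (maximalRealSubfield L)) 3
  rw [Nat.cast_ofNat, RingOfIntegers.rank, finrank_rat_maximalRealSubfield L, pow_one] at h
  exact h

/-- **`N(vThreePlus) = 3`**: the prime `vThreePlus` of `𝓞_{ℚ(i)⁺}` contains `3`, so its norm divides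
`N((3)) = 3`, and it is not `1` (the ideal is proper). -/
theorem absNorm_vThreePlus :
    haveI := numberField L; haveI := isCMField_four L
    Ideal.absNorm (vThreePlus L).asIdeal = 3 := by
  haveI := numberField L
  haveI := isCMField_four L
  have hdvd : Ideal.absNorm (vThreePlus L).asIdeal ∣
      Ideal.absNorm (Ideal.span {(3 : 𝓞 (maximalRealSubfield L))}) :=
    Ideal.absNorm_dvd_absNorm_of_le ((Ideal.span_singleton_le_iff_mem _).mpr (three_mem_vThreePlus L))
  rw [absNorm_span_three L] at hdvd
  rcases Nat.prime_three.eq_one_or_self_of_dvd _ hdvd with h | h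
  · exact absurd (Ideal.absNorm_eq_one_iff.mp h) (vThreePlus L).isPrime.ne_top
  · exact h

end Norm

section Congruence

/-- Congruence of the scalars in a three-term relation (the instances are free so that the unification with a
Hecke-algebra identity is first-order — a `rw` on the scalars inside these terms exceeds the heartbeat budget). -/
theorem three_term_congr {k A : Type*} [Add A] [Mul A] [SMul k A] {a a' b b' : k} {T S U V : A}
    (ha : a = a') (hb : b = b') (h : T * S = U + a • S + b • V) : T * S = U + a' • S + b' • V := by
  subst ha; subst hb; exact h

end Congruence

section Record

variable (L : Type*) [Field L] [CharZero L] [IsCyclotomicExtension {2 ^ 2} ℚ L]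

/-- **`deg T₁ = 84` AT THE INERT PLACE `(3)` OF `ℚ(i)`** (file 245's datum-free generator with
`(N(v)³ + 1) · N(v) = (27 + 1) · 3 = 84`): for every family `l` of generators of `𝓞_{ℚ(i)}` over `𝓞_{ℚ(i)⁺}` and
every field `k`, some `g₀ ∈ U(1 ⊗ H₀)` has a double coset `K_{(3)} g₀ K_{(3)}` of exactly `84` left cosets whose
characteristic function `T₁` generates `H(U(1 ⊗ H₀), K_{(3)})` (`aeval T₁ : k[X] → H` bijective). -/
theorem exists_doubleCosetOp_aeval_bijective_and_ncard_record_three (k : Type*) [Field k] {r : ℕ}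
    (l : Fin r → 𝓞 L) (hl : Submodule.span (𝓞 (maximalRealSubfield L)) (Set.range l) = ⊤) :
    haveI := numberField L; haveI := isCMField_four L
    ∃ g₀ : (letI := tensorStarRing L (vThreePlus L); ↥(formUnitaryGroup (tensorGram L (vThreePlus L) (gramToy L)))),
      (orbit (recordHyperspecial L (vThreePlus L) l (gramToy L))
        (g₀ : _ ⧸ recordHyperspecial L (vThreePlus L) l (gramToy L))).ncard = 84 ∧
      ∃ _ : Finite (orbit (recordHyperspecial L (vThreePlus L) l (gramToy L))
          (g₀ : _ ⧸ recordHyperspecial L (vThreePlus L) l (gramToy L))),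
        Function.Bijective (aeval (doubleCosetOp k (recordHyperspecial L (vThreePlus L) l (gramToy L)) g₀) :
          k[X] →ₐ[k] heckeAlgebra k (recordHyperspecial L (vThreePlus L) l (gramToy L))) := by
  haveI := numberField L
  haveI := isCMField_four L
  have key := @exists_doubleCosetOp_aeval_bijective_and_ncard_record_of_staysPrime L _ (numberField L)
    (isCMField_four L) (vThreePlus L) (wThree L) _ (map_vThreePlus L) _ l k _ hl _ gramToy_isHermitian
    isUnit_det_gramToy (notMem_badSet_gramToy _)
  obtain ⟨g₀, hn, hb⟩ := key
  exact ⟨g₀, hn.trans (by rw [absNorm_vThreePlus L]; norm_num), hb⟩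

/-- **THE TREE RECURSION AT THE INERT PLACE `(3)` OF `ℚ(i)`, AS NUMERALS** (file 248's datum-free recursion with
`N(v) = 3`: `N(v) − 1 = 2`, `N(v)⁴ = 81`, `N(v)⁴ + N(v) = 84`): for every family `l` of generators and every field
`k` of characteristic `0`, cells `gₙ ∈ U(1 ⊗ H₀)` with finite double cosets and `Tₙ := 1_{K_{(3)} gₙ K_{(3)}}`
satisfy `T₁ T_{n+2} = T_{n+3} + 2 T_{n+2} + 81 T_{n+1}` and `T₁² = T₂ + 2 T₁ + 84 T₀`. -/
theorem exists_cells_three_term_record_three (k : Type*) [Field k] [CharZero k] {r : ℕ}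
    (l : Fin r → 𝓞 L) (hl : Submodule.span (𝓞 (maximalRealSubfield L)) (Set.range l) = ⊤) :
    haveI := numberField L; haveI := isCMField_four L
    ∃ g : ℕ → (letI := tensorStarRing L (vThreePlus L);
        ↥(formUnitaryGroup (tensorGram L (vThreePlus L) (gramToy L)))),
      ∃ hfin : ∀ n, Finite (orbit (recordHyperspecial L (vThreePlus L) l (gramToy L))
          (g n : _ ⧸ recordHyperspecial L (vThreePlus L) l (gramToy L))),
        (∀ n, letI := hfin 1; letI := hfin (n + 1 + 1); letI := hfin (n + 1 + 1 + 1); letI := hfin (n + 1);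
          doubleCosetOp k (recordHyperspecial L (vThreePlus L) l (gramToy L)) (g 1) *
              doubleCosetOp k (recordHyperspecial L (vThreePlus L) l (gramToy L)) (g (n + 1 + 1)) =
            doubleCosetOp k (recordHyperspecial L (vThreePlus L) l (gramToy L)) (g (n + 1 + 1 + 1)) +
              (2 : k) • doubleCosetOp k (recordHyperspecial L (vThreePlus L) l (gramToy L)) (g (n + 1 + 1)) +
              (81 : k) • doubleCosetOp k (recordHyperspecial L (vThreePlus L) l (gramToy L)) (g (n + 1))) ∧
        (letI := hfin 1; letI := hfin (0 + 1); letI := hfin (0 + 1 + 1); letI := hfin 0;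
          doubleCosetOp k (recordHyperspecial L (vThreePlus L) l (gramToy L)) (g 1) *
              doubleCosetOp k (recordHyperspecial L (vThreePlus L) l (gramToy L)) (g (0 + 1)) =
            doubleCosetOp k (recordHyperspecial L (vThreePlus L) l (gramToy L)) (g (0 + 1 + 1)) +
              (2 : k) • doubleCosetOp k (recordHyperspecial L (vThreePlus L) l (gramToy L)) (g (0 + 1)) +
              (84 : k) • doubleCosetOp k (recordHyperspecial L (vThreePlus L) l (gramToy L)) (g 0)) := by
  haveI := numberField L
  haveI := isCMField_four L
  have e1 : ((Ideal.absNorm (vThreePlus L).asIdeal : k) - 1) = 2 := by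
    rw [absNorm_vThreePlus L]; norm_num
  have e2 : (Ideal.absNorm (vThreePlus L).asIdeal : k) ^ 4 = 81 := by
    rw [absNorm_vThreePlus L]; norm_num
  have e3 : (Ideal.absNorm (vThreePlus L).asIdeal : k) ^ 4 + Ideal.absNorm (vThreePlus L).asIdeal = 84 := by
    rw [absNorm_vThreePlus L]; norm_num
  have key := @exists_cells_three_term_record_of_staysPrime' L _ (numberField L) (isCMField_four L) (vThreePlus L)
    (wThree L) _ (map_vThreePlus L) _ l k _ _ hl _ gramToy_isHermitian isUnit_det_gramToy (notMem_badSet_gramToy _)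
  obtain ⟨g, hfin, h1, h2⟩ := key
  exact ⟨g, hfin, fun n => three_term_congr e1 e2 (h1 n), three_term_congr e1 e3 h2⟩

/-- The generator of degree `84` with the generators `l` supplied (file 235's `exists_fin_span_eq_top`). -/
theorem exists_generators_and_doubleCosetOp_aeval_bijective_and_ncard_record_three (k : Type*) [Field k] :
    haveI := numberField L; haveI := isCMField_four L
    ∃ (r : ℕ) (l : Fin r → 𝓞 L), Submodule.span (𝓞 (maximalRealSubfield L)) (Set.range l) = ⊤ ∧
      ∃ g₀ : (letI := tensorStarRing L (vThreePlus L);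
          ↥(formUnitaryGroup (tensorGram L (vThreePlus L) (gramToy L)))),
        (orbit (recordHyperspecial L (vThreePlus L) l (gramToy L))
          (g₀ : _ ⧸ recordHyperspecial L (vThreePlus L) l (gramToy L))).ncard = 84 ∧
        ∃ _ : Finite (orbit (recordHyperspecial L (vThreePlus L) l (gramToy L))
            (g₀ : _ ⧸ recordHyperspecial L (vThreePlus L) l (gramToy L))),
          Function.Bijective (aeval (doubleCosetOp k (recordHyperspecial L (vThreePlus L) l (gramToy L)) g₀) :
            k[X] →ₐ[k] heckeAlgebra k (recordHyperspecial L (vThreePlus L) l (gramToy L))) :=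
  haveI := numberField L
  haveI := isCMField_four L
  (exists_fin_span_eq_top L).elim fun r h => h.elim fun l hl =>
    ⟨r, l, hl, exists_doubleCosetOp_aeval_bijective_and_ncard_record_three L k l hl⟩

end Record

end Summit.Ventures.HodgeRepro2.T5RecordSatakeInertToyDegree
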